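import Literature.Analysis.Fourier.StationaryPhaseInertNonstationary
import HarnessLib

/-!
# Blomer–Khan–Young 2013, Lemma 8.1 (repeated integration by parts), in its printed letter — PROVED

Topic `Literature/Analysis/Fourier`; proof-lane file, THEOREMS ONLY (no definition, no named fact).  Companion of
`StationaryPhaseInertNonstationary.lean` (same seat), which proves the Kıral–Petrow–Young normalisation
(`[Z, 2Z]`, `w^{(j)} ≪ (Z/X)^{-j}`, `φ^{(j)} ≪ Y/Zʲ`, `|φ′| ≫ Y/Z`) of the same lemma; here the ORIGINAL five-parameter
letter of [BlomerKhanYoung2013, Lemma 8.1] is proved, which is the form cited throughout the analytic-number-theory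
literature.

THE RESULT (as printed, arXiv:1203.2573 §8).  «**Lemma 8.1.**  Let `Y ≥ 1`, `X, Q, U, R > 0`, and suppose that `w` is a
smooth function with support on `[α, β]`, satisfying `w^{(j)}(t) ≪_j X U^{-j}`.  Suppose `h` is a smooth function on `[α, β]`
such that `|h′(t)| ≥ R` for some `R > 0`, and `h^{(j)}(t) ≪_j Y Q^{-j}` for `j = 2, 3, …`.  Then the integral `I` defined by
`I = ∫_ℝ w(t) e^{ih(t)} dt` satisfies `I ≪_A (β − α) X [(QR/√Y)^{-A} + (RU)^{-A}]`.»  Typed as `norm_oscInt_le_repeatedIBP`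
with the implied constants made explicit in the usual way: the tables `C_w, C_h : ℕ → ℝ` of the hypotheses
`‖w^{(j)}(t)‖ ≤ C_w(j) X/Uʲ` (all `j`, all `t`) and `|h^{(j)}(t)| ≤ C_h(j) Y/Qʲ` (`j ≥ 2`, `t ∈ [α, β]`) and the exponent
`A ≥ 0` are quantified BEFORE the instance, and the conclusion is `‖I‖ ≤ K (β − α) X ((QR/√Y)^{-A} + (RU)^{-A})` with
`K = K(C_w, C_h, A)`.  «Smooth on `[α, β]`» is typed as `ContDiff ℝ ∞ h` on the line
(`-- TODO(general form): h smooth only on a neighbourhood of [α, β]` — the integral only sees `h` on the support of `w`).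

THE PROOF is the printed one: `𝒟(f) = −(f/(ih′))′ = i(f/h′)′`, `∫ f e^{ih} = ∫ 𝒟ⁿ(f) e^{ih}` and
`|I| ≤ (β − α)‖𝒟ⁿ w‖_∞` (the identities `oscInt_eq_oscInt_step'`, `norm_oscInt_le_of_forall_le'` below), with BKY's displayed
monomial expansion of `𝒟ⁿ f` (proof of Lemma 8.1) organised as the inductive jet bound of the sibling file: writing `ρ = 1/U + 1/Q + Y/(Q²R)` one has
`|(1/h′)^{(j)}| ≤ (1/R) M^{2ⁿ−1} ρʲ` (`j ≤ n`, `M = max(1, 4ⁿ Σ_{i≤n+2}|C_h(i)|)`; the abstract reciprocal induction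
`abs_iteratedDeriv_le_of_deriv_eq_neg_mul_sq` of the sibling file with `L = 1/R`, `ρ₀ = 1/Q + Y/(Q²R)`, `P = Σ|C_h|·Y/Q²`,
`D = Σ|C_h|`) and each application of `𝒟` costs the factor `2^{m+1} M^{2ⁿ−1} ρ/R`, where
`ρ/R = 1/(RU) + 1/(RQ) + Y/(QR)² ≤ (RU)^{-1} + 2·(√Y/(QR))` as long as `√Y/(QR) ≤ 1` (and `Y ≥ 1`); if `√Y/(QR) > 1` or
`1/(RU) > 1` the claimed bound exceeds the trivial bound `|I| ≤ (β − α)·C_w(0)·X`.  Hence after `n = ⌈A⌉₊` steps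
`|I| ≤ (β − α) X N₀ (3·2^{n+1}M^{2ⁿ−1})ⁿ max((RU)^{-1}, √Y/(QR))ⁿ` with `N₀ = Σ_{j≤n}|C_w(j)|`, and
`maxⁿ ≤ max^A ≤ (QR/√Y)^{-A} + (RU)^{-A}` (bases `≤ 1`), giving `K = N₀ (3·2^{n+1} M^{2ⁿ−1})ⁿ`.

## References
* [BlomerKhanYoung2013] V. Blomer, R. Khan, M. Young, *Distribution of mass of holomorphic cusp forms*, Duke Math. J.
  162 (2013) 2609–2644 (arXiv:1203.2573), §8, Lemma 8.1 and its proof.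
* [KiralPetrowYoung2019] E. M. Kıral, I. Petrow, M. P. Young, *Oscillatory integrals with uniformity in parameters*,
  J. Théor. Nombres Bordeaux 31 (2019) 145–159, Lemma 3.1 (the inert restatement).
-/

noncomputable section

open MeasureTheory Set Filter Topology Finset
open scoped ContDiff

namespace Literature.Analysis.Fourier

namespace InertStationaryPhase

/-! ### §1 The operator `𝒟`, the integration-by-parts identity and the trivial bound on a general interval `[α, β]` -/

section Interval

/-- A function vanishing off a closed set `I` has its derivative vanishing off `I`. [folklore] -/
private theorem deriv_eq_zero_off' {I : Set ℝ} (hI : IsClosed I) {u : ℝ → ℂ} (hu0 : ∀ t ∉ I, u t = 0) :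
    ∀ t ∉ I, deriv u t = 0 := by
  intro t ht
  have hev : u =ᶠ[𝓝 t] fun _ => (0 : ℂ) := by
    filter_upwards [hI.isOpen_compl.mem_nhds ht] with s hs
    exact hu0 s hs
  rw [hev.deriv_eq, deriv_const]

/-- If `f` is `C^∞`, vanishes off a closed set `I`, and `v` is `C^∞` on an open set `U ⊇ I`, then `v • f` is `C^∞`. [folklore] -/
private theorem contDiff_smul_of_eq_zero_off' {U I : Set ℝ} (hU : IsOpen U) (hI : IsClosed I) (hIU : I ⊆ U)
    {v : ℝ → ℝ} {f : ℝ → ℂ} (hv : ContDiffOn ℝ ∞ v U) (hf : ContDiff ℝ ∞ f) (hf0 : ∀ t ∉ I, f t = 0) :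
    ContDiff ℝ ∞ (fun s => v s • f s) := by
  rw [contDiff_iff_contDiffAt]
  intro t
  by_cases ht : t ∈ U
  · exact (hv.smul hf.contDiffOn).contDiffAt (hU.mem_nhds ht)
  · have htI : t ∉ I := fun h => ht (hIU h)
    have hev : (fun s => v s • f s) =ᶠ[𝓝 t] fun _ => (0 : ℂ) := by
      filter_upwards [hI.isOpen_compl.mem_nhds htI] with s hs
      simp [hf0 s hs]
    exact contDiffAt_const.congr_of_eventuallyEq hev

/-- A derivative of a `C^∞` function is `C^∞`. [folklore] -/
private theorem contDiff_deriv_of_contDiff'' {F : Type*} [NormedAddCommGroup F] [NormedSpace ℝ F] {u : ℝ → F}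
    (hu : ContDiff ℝ ∞ u) : ContDiff ℝ ∞ (deriv u) :=
  (contDiff_infty_iff_deriv.mp hu).2

/-- **The step on `[α, β]`**: if `|v^{(j)}| ≤ B_v ρʲ` and `‖f^{(j)}‖ ≤ N ρʲ` on `[α, β]` for `j ≤ m + 1` (`v` smooth on an open
`U ⊇ [α, β]`, `f` smooth), then `g = i·(v f)′` satisfies `‖g^{(j)}‖ ≤ (2^{m+1} B_v ρ N)·ρʲ` on `[α, β]` for `j ≤ m` — one
application of the operator `𝒟` of [cite: BlomerKhanYoung2013, Lemma 8.1 (proof)]. -/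
theorem norm_iteratedDeriv_step_le' {U : Set ℝ} {α β : ℝ} (hU : IsOpen U) (hIU : Icc α β ⊆ U)
    {v : ℝ → ℝ} {f : ℝ → ℂ} (hv : ContDiffOn ℝ ∞ v U) (hf : ContDiff ℝ ∞ f) {m : ℕ} {Bv N ρ : ℝ}
    (hρ : 0 ≤ ρ) (hBv : 0 ≤ Bv) (hN : 0 ≤ N)
    (hvb : ∀ j ≤ m + 1, ∀ t ∈ Icc α β, |iteratedDeriv j v t| ≤ Bv * ρ ^ j)
    (hfb : ∀ j ≤ m + 1, ∀ t ∈ Icc α β, ‖iteratedDeriv j f t‖ ≤ N * ρ ^ j) :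
    ∀ j ≤ m, ∀ t ∈ Icc α β,
      ‖iteratedDeriv j (fun s => Complex.I * deriv (fun r => v r • f r) s) t‖ ≤ (2 ^ (m + 1) * Bv * ρ * N) * ρ ^ j := by
  intro j hj t ht
  have htU : t ∈ U := hIU ht
  rw [iteratedDeriv_const_mul_field, norm_mul, Complex.norm_I, one_mul, ← iteratedDeriv_succ']
  have h := norm_iteratedDeriv_smul_le_of_geometric_of_isOpen hU hv hf.contDiffOn htU (n := j + 1) hρ
    (fun i hi => by rw [Real.norm_eq_abs]; exact hvb i (by omega) t ht) (fun i hi => hfb i (by omega) t ht)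
  refine h.trans ?_
  have h2 : (2 : ℝ) ^ (j + 1) ≤ 2 ^ (m + 1) := pow_le_pow_right₀ one_le_two (by omega)
  have hnn : 0 ≤ Bv * N * ρ ^ (j + 1) := mul_nonneg (mul_nonneg hBv hN) (pow_nonneg hρ _)
  calc 2 ^ (j + 1) * Bv * N * ρ ^ (j + 1) = 2 ^ (j + 1) * (Bv * N * ρ ^ (j + 1)) := by ring
    _ ≤ 2 ^ (m + 1) * (Bv * N * ρ ^ (j + 1)) := mul_le_mul_of_nonneg_right h2 hnn
    _ = 2 ^ (m + 1) * Bv * ρ * N * ρ ^ j := by ring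

/-- `t ↦ e^{ih(t)}` has derivative `e^{ih(t)}·(ih′(t))`. [folklore] -/
private theorem hasDerivAt_cexp_I_mul' {h : ℝ → ℝ} (hh : ContDiff ℝ ∞ h) (t : ℝ) :
    HasDerivAt (fun s => Complex.exp (Complex.I * h s))
      (Complex.exp (Complex.I * h t) * (Complex.I * (deriv h t : ℝ))) t := by
  have hd : HasDerivAt h (deriv h t) t := ((hh.differentiable (by simp)).differentiableAt).hasDerivAt
  have h1 : HasDerivAt (fun s => Complex.I * (h s : ℂ)) (Complex.I * (deriv h t : ℝ)) t := by
    simpa using hd.ofReal_comp.const_mul Complex.I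
  exact h1.cexp

/-- **`∫ f e^{ih} = ∫ i(f/h′)′ e^{ih}`** for `f` smooth and supported in `[α, β]`, where `v = 1/h′` on `[α, β]` and `v • f` is
smooth (integration by parts on the line, no boundary terms): the identity `∫ f e^{ih} = ∫ 𝒟(f) e^{ih}` of
[cite: BlomerKhanYoung2013, Lemma 8.1 (proof)]. -/
theorem oscInt_eq_oscInt_step' {h : ℝ → ℝ} (hh : ContDiff ℝ ∞ h) {α β : ℝ} {v : ℝ → ℝ} {f : ℝ → ℂ}
    (hu : ContDiff ℝ ∞ (fun s => v s • f s)) (hf0 : ∀ t ∉ Icc α β, f t = 0)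
    (hvh : ∀ t ∈ Icc α β, deriv h t * v t = 1) :
    oscInt f h = oscInt (fun s => Complex.I * deriv (fun r => v r • f r) s) h := by
  set u : ℝ → ℂ := fun s => v s • f s with hu_def
  set e : ℝ → ℂ := fun s => Complex.exp (Complex.I * h s) with he_def
  set e' : ℝ → ℂ := fun s => Complex.exp (Complex.I * h s) * (Complex.I * (deriv h s : ℝ)) with he'_def
  have hu0 : ∀ t ∉ Icc α β, u t = 0 := fun t ht => by simp [hu_def, hf0 t ht]
  have hdu0 : ∀ t ∉ Icc α β, deriv u t = 0 := deriv_eq_zero_off' isClosed_Icc hu0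
  have hus : HasCompactSupport u := HasCompactSupport.intro isCompact_Icc hu0
  have hdus : HasCompactSupport (deriv u) := HasCompactSupport.intro isCompact_Icc hdu0
  have huc : Continuous u := hu.continuous
  have hduc : Continuous (deriv u) := hu.continuous_deriv (by simp)
  have hhc : Continuous h := hh.continuous
  have hdhc : Continuous (deriv h) := hh.continuous_deriv (by simp)
  have hec : Continuous e := by
    simp only [he_def]; fun_prop
  have he'c : Continuous e' := by
    simp only [he'_def]; fun_prop
  have hpt : ∀ s, f s * e s = -Complex.I * (u s * e' s) := by
    intro s
    by_cases hs : s ∈ Icc α β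
    · have h1 : ((deriv h s : ℝ) : ℂ) * ((v s : ℝ) : ℂ) = 1 := by exact_mod_cast hvh s hs
      simp only [hu_def, he'_def, Complex.real_smul]
      linear_combination (-(f s * Complex.exp (Complex.I * h s))) * h1
        + (((deriv h s : ℝ) : ℂ) * ((v s : ℝ) : ℂ) * f s * Complex.exp (Complex.I * h s)) * Complex.I_sq
    · simp [hu0 s hs, hf0 s hs]
  have hibp := integral_mul_deriv_eq_deriv_mul_of_integrable (u := u) (v := e) (u' := deriv u) (v' := e')
    (fun x _ => ((hu.differentiable (by simp)).differentiableAt).hasDerivAt)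
    (fun x _ => hasDerivAt_cexp_I_mul' hh x)
    ((huc.mul he'c).integrable_of_hasCompactSupport hus.mul_right)
    ((hduc.mul hec).integrable_of_hasCompactSupport hdus.mul_right)
    ((huc.mul hec).integrable_of_hasCompactSupport hus.mul_right)
  unfold oscInt
  calc ∫ t, f t * Complex.exp (Complex.I * h t) = ∫ t, -Complex.I * (u t * e' t) := by
        refine integral_congr_ae (Eventually.of_forall fun s => ?_); exact hpt s
    _ = -Complex.I * ∫ t, u t * e' t := integral_const_mul _ _
    _ = -Complex.I * -∫ t, deriv u t * e t := by rw [hibp]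
    _ = Complex.I * ∫ t, deriv u t * e t := by ring
    _ = ∫ t, Complex.I * (deriv u t * e t) := (integral_const_mul _ _).symm
    _ = ∫ t, Complex.I * deriv (fun r => v r • f r) t * Complex.exp (Complex.I * h t) := by
        refine integral_congr_ae (Eventually.of_forall fun s => ?_)
        simp only [hu_def, he_def, mul_assoc]

/-- **`|∫ g e^{ih}| ≤ (β − α)·sup|g|`** for `g` vanishing off `[α, β]` (`α ≤ β`) with `‖g‖ ≤ N` there — the first inequality
of the last display of [cite: BlomerKhanYoung2013, Lemma 8.1 (proof)]. -/
theorem norm_oscInt_le_of_forall_le' {g : ℝ → ℂ} (h : ℝ → ℝ) {α β N : ℝ} (hαβ : α ≤ β)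
    (hg0 : ∀ t ∉ Icc α β, g t = 0) (hgN : ∀ t ∈ Icc α β, ‖g t‖ ≤ N) :
    ‖oscInt g h‖ ≤ N * (β - α) := by
  unfold oscInt
  rw [← setIntegral_eq_integral_of_forall_compl_eq_zero (s := Icc α β)
    (fun t ht => by rw [hg0 t ht, zero_mul])]
  have hvol : volume (Icc α β) < ⊤ := by simp
  refine (norm_setIntegral_le_of_norm_le_const (C := N) hvol fun t ht => ?_).trans ?_
  · rw [norm_mul, mul_comm Complex.I, Complex.norm_exp_ofReal_mul_I, mul_one]; exact hgN t ht
  · rw [Real.volume_real_Icc, max_eq_left (sub_nonneg.mpr hαβ)]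

end Interval

/-! ### §2 The reciprocal table for `1/h′` in the scales `(R, Y, Q)` -/

section Reciprocal

/-- Iterating derivatives composes additively in the order. [folklore] -/
private theorem iteratedDeriv_iteratedDeriv' (a b : ℕ) (f : ℝ → ℝ) :
    iteratedDeriv a (iteratedDeriv b f) = iteratedDeriv (a + b) f := by
  rw [iteratedDeriv_eq_iterate, iteratedDeriv_eq_iterate, iteratedDeriv_eq_iterate]
  exact (Function.iterate_add_apply deriv a b f).symm

/-- **The reciprocal table for `1/h′` in BKY's scales.**  If `h` is `C^∞`, `|h′| ≥ R > 0` and `|h^{(j)}| ≤ C_h(j) Y/Qʲ`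
(`j ≥ 2`) on `[α, β]` (`Q > 0`, `Y ≥ 0`), then with `ρ₀ = 1/Q + Y/(Q²R)` and `M = max(1, 4ⁿ Σ_{i<n+3}|C_h(i)|)`:
`|(1/h′)^{(j)}(t)| ≤ (1/R)·M^{2ⁿ−1}·ρ₀ʲ` for `j ≤ n`, `t ∈ [α, β]` (induction from `(1/h′)′ = −h″(1/h′)²`).
[cite: BlomerKhanYoung2013, Lemma 8.1 (proof)] -/
theorem abs_iteratedDeriv_inv_deriv_le' {h : ℝ → ℝ} (hh : ContDiff ℝ ∞ h) {α β R Y Q : ℝ} (hR : 0 < R) (hY : 0 ≤ Y)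
    (hQ : 0 < Q) {Ch : ℕ → ℝ} (n : ℕ)
    (hhb : ∀ j : ℕ, 2 ≤ j → ∀ t ∈ Icc α β, |iteratedDeriv j h t| ≤ Ch j * Y / Q ^ j)
    (hh' : ∀ t ∈ Icc α β, R ≤ |deriv h t|) :
    ∀ j ≤ n, ∀ t ∈ Icc α β,
      |iteratedDeriv j (fun s => (deriv h s)⁻¹) t| ≤
        1 / R * (max 1 (4 ^ n * ∑ i ∈ Finset.range (n + 3), |Ch i|)) ^ (2 ^ n - 1) * (1 / Q + Y / (Q ^ 2 * R)) ^ j := by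
  set Aφ : ℝ := ∑ i ∈ Finset.range (n + 3), |Ch i| with hAφ
  have hAφ0 : 0 ≤ Aφ := Finset.sum_nonneg fun i _ => abs_nonneg _
  have hCle : ∀ i < n + 3, Ch i ≤ Aφ := fun i hi =>
    (le_abs_self _).trans (Finset.single_le_sum (f := fun i => |Ch i|) (fun i _ => abs_nonneg _)
      (Finset.mem_range.mpr hi))
  -- the open set `U = {h′ ≠ 0} ⊇ [α, β]`
  have hU : IsOpen {t : ℝ | deriv h t ≠ 0} := isOpen_ne_fun (hh.continuous_deriv (by simp)) continuous_const
  have hIU : Icc α β ⊆ {t : ℝ | deriv h t ≠ 0} := fun t ht h0 => by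
    have := hh' t ht; rw [h0, abs_zero] at this; exact absurd this (not_le.mpr hR)
  have hd : ContDiff ℝ ∞ (deriv h) := (contDiff_infty_iff_deriv.mp hh).2
  have hv : ContDiffOn ℝ ∞ (fun s => (deriv h s)⁻¹) {t : ℝ | deriv h t ≠ 0} := hd.contDiffOn.inv fun _ ht => ht
  have hψ : ContDiff ℝ ∞ (iteratedDeriv 2 h) := by
    rw [iteratedDeriv_eq_iterate]; exact hh.iterate_deriv 2
  -- `(1/h′)′ = −h″ (1/h′)²` on `U`
  have hder : Set.EqOn (deriv fun s => (deriv h s)⁻¹)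
      (fun s => -(iteratedDeriv 2 h s * ((deriv h s)⁻¹ * (deriv h s)⁻¹))) {t : ℝ | deriv h t ≠ 0} := by
    intro t ht
    have hd1 : HasDerivAt (deriv h) (deriv (deriv h) t) t :=
      ((hd.differentiable (by simp)).differentiableAt).hasDerivAt
    have h1 := (hd1.inv ht).deriv
    have h2 : deriv (deriv h) t = iteratedDeriv 2 h t := by
      rw [iteratedDeriv_succ, iteratedDeriv_one]
    simp only at h1 ⊢
    rw [show (fun s => (deriv h s)⁻¹) = (deriv h)⁻¹ from rfl, h1, h2]
    field_simp
  have hρ₀ : 0 ≤ 1 / Q + Y / (Q ^ 2 * R) := by positivity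
  refine abs_iteratedDeriv_le_of_deriv_eq_neg_mul_sq hU hIU hv hψ.contDiffOn hder
    (L := 1 / R) (P := Aφ * Y / Q ^ 2) (ρ₀ := 1 / Q + Y / (Q ^ 2 * R)) (D := Aφ)
    (by positivity) hρ₀ hAφ0 (le_max_left _ _) (le_max_right _ _) ?_ ?_ ?_ n le_rfl
  · -- `P·L ≤ D·ρ₀`: `Aφ Y/(Q²R) ≤ Aφ (1/Q + Y/(Q²R))`
    have : Aφ * Y / Q ^ 2 * (1 / R) = Aφ * (Y / (Q ^ 2 * R)) := by field_simp
    rw [this]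
    exact mul_le_mul_of_nonneg_left (le_add_of_nonneg_left (by positivity)) hAφ0
  · -- `|1/h′| ≤ 1/R`
    intro t ht
    rw [abs_inv, one_div]
    exact inv_anti₀ hR (hh' t ht)
  · -- `|ψ^{(a)}| ≤ P ρ₀ᵃ`
    intro a ha t ht
    rw [iteratedDeriv_iteratedDeriv']
    have h1 := hhb (a + 2) (by omega) t ht
    refine h1.trans ?_
    have hYQ : 0 ≤ Y / Q ^ (a + 2) := by positivity
    calc Ch (a + 2) * Y / Q ^ (a + 2) = Ch (a + 2) * (Y / Q ^ (a + 2)) := by ring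
      _ ≤ Aφ * (Y / Q ^ (a + 2)) := mul_le_mul_of_nonneg_right (hCle _ (by omega)) hYQ
      _ = Aφ * Y / Q ^ 2 * (1 / Q) ^ a := by rw [one_div_pow, pow_add]; field_simp
      _ ≤ Aφ * Y / Q ^ 2 * (1 / Q + Y / (Q ^ 2 * R)) ^ a :=
          mul_le_mul_of_nonneg_left (pow_le_pow_left₀ (by positivity) (le_add_of_nonneg_right (by positivity)) a)
            (by positivity)

end Reciprocal

/-! ### §3 The lemma -/

section Main

/-- For `0 < x ≤ 1` and `⌈A⌉₊ = n` (`A ≥ 0`): `xⁿ ≤ x^A`. [folklore] -/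
private theorem pow_natCeil_le_rpow {x A : ℝ} (hx0 : 0 < x) (hx1 : x ≤ 1) :
    x ^ ⌈A⌉₊ ≤ x ^ A := by
  rw [← Real.rpow_natCast]
  exact Real.rpow_le_rpow_of_exponent_ge hx0 hx1 (Nat.le_ceil A)

/-- `(x⁻¹)^A = x^{-A}` for `x ≥ 0`. [folklore] -/
private theorem inv_rpow_eq_rpow_neg {x A : ℝ} (hx : 0 ≤ x) : x⁻¹ ^ A = x ^ (-A) := by
  rw [Real.inv_rpow hx, Real.rpow_neg hx]

/-- **Blomer–Khan–Young 2013, Lemma 8.1 (repeated integration by parts) — PROVED in its printed letter.**  «Let `Y ≥ 1`,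
`X, Q, U, R > 0`, and suppose that `w` is a smooth function with support on `[α, β]`, satisfying `w^{(j)}(t) ≪_j X U^{-j}`.
Suppose `h` is a smooth function on `[α, β]` such that `|h′(t)| ≥ R` for some `R > 0`, and `h^{(j)}(t) ≪_j Y Q^{-j}` for
`j = 2, 3, …`.  Then `I = ∫_ℝ w(t) e^{ih(t)} dt` satisfies `I ≪_A (β − α) X [(QR/√Y)^{-A} + (RU)^{-A}]`.»  The tables
`C_w, C_h` of the two `≪_j` and the exponent `A ≥ 0` are quantified first; `K = K(C_w, C_h, A)`
(`= (Σ_{j≤n}|C_w(j)|)·(3·2^{n+1}·M^{2ⁿ−1})ⁿ`, `n = ⌈A⌉₊`, `M = max(1, 4ⁿ Σ_{i≤n+2}|C_h(i)|)`).  «Smooth on `[α, β]`» is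
typed `ContDiff ℝ ∞ h`. `-- TODO(general form): h smooth on a neighbourhood of [α, β] only.`
PROOF: the printed one (operator `𝒟`, `∫ f e^{ih} = ∫ 𝒟ⁿ f e^{ih}`, `|I| ≤ (β−α)‖𝒟ⁿ w‖_∞`), the monomial expansion of
`𝒟ⁿ w` organised as an inductive jet bound with ratio `ρ = 1/U + 1/Q + Y/(Q²R)` and gain `ρ/R ≤ (RU)^{-1} + 2√Y/(QR)` per
step (when `√Y/(QR) ≤ 1`; otherwise, or when `RU < 1`, the claim is weaker than the trivial bound).
[cite: BlomerKhanYoung2013, Lemma 8.1] -/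
theorem norm_oscInt_le_repeatedIBP :
    ∀ (Cw Ch : ℕ → ℝ) (A : ℝ), 0 ≤ A → ∃ K : ℝ,
    ∀ (w : ℝ → ℂ) (h : ℝ → ℝ) (α β X Y Q U R : ℝ), α ≤ β → 0 < X → 1 ≤ Y → 0 < Q → 0 < U → 0 < R →
      ContDiff ℝ ∞ w → (∀ t, t ∉ Icc α β → w t = 0) →
      (∀ (j : ℕ) (t : ℝ), ‖iteratedDeriv j w t‖ ≤ Cw j * X / U ^ j) → ContDiff ℝ ∞ h →
      (∀ t ∈ Icc α β, R ≤ |deriv h t|) →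
      (∀ j : ℕ, 2 ≤ j → ∀ t ∈ Icc α β, |iteratedDeriv j h t| ≤ Ch j * Y / Q ^ j) →
        ‖oscInt w h‖ ≤ K * (β - α) * X * ((Q * R / Real.sqrt Y) ^ (-A) + (R * U) ^ (-A)) := by
  intro Cw Ch A hA
  set n : ℕ := ⌈A⌉₊ with hn
  set N₀ : ℝ := ∑ j ∈ Finset.range (n + 1), |Cw j| with hN₀
  set M : ℝ := max 1 (4 ^ n * ∑ i ∈ Finset.range (n + 3), |Ch i|) with hM
  set Bφ : ℝ := M ^ (2 ^ n - 1) with hBφ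
  refine ⟨N₀ * (3 * 2 ^ (n + 1) * Bφ) ^ n, ?_⟩
  intro w h α β X Y Q U R hαβ hX hY hQ hU hR hw hw0 hwb hh hh' hhb
  have hN₀0 : 0 ≤ N₀ := Finset.sum_nonneg fun j _ => abs_nonneg _
  have hCw0 : |Cw 0| ≤ N₀ :=
    Finset.single_le_sum (f := fun i => |Cw i|) (fun i _ => abs_nonneg _) (Finset.mem_range.mpr (Nat.succ_pos n))
  have hM1 : 1 ≤ M := le_max_left _ _
  have hM0 : 0 ≤ M := zero_le_one.trans hM1
  have hBφ1 : 1 ≤ Bφ := one_le_pow₀ hM1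
  have hBφ0 : 0 ≤ Bφ := zero_le_one.trans hBφ1
  have hY0 : 0 < Y := one_pos.trans_le hY
  have hsY1 : 1 ≤ Real.sqrt Y := by rw [← Real.sqrt_one]; exact Real.sqrt_le_sqrt hY
  have hsY0 : 0 < Real.sqrt Y := one_pos.trans_le hsY1
  -- the base constant `Kb = (3·2^{n+1}·Bφ)ⁿ ≥ 1` and `K = N₀ Kb`
  set Kb : ℝ := (3 * 2 ^ (n + 1) * Bφ) ^ n with hKb
  have hKb1 : 1 ≤ Kb :=
    one_le_pow₀ (one_le_mul_of_one_le_of_one_le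
      (one_le_mul_of_one_le_of_one_le (by norm_num) (one_le_pow₀ one_le_two)) hBφ1)
  -- the two small parameters `a = √Y/(QR)`, `b = 1/(RU)` and the right-hand side
  set a : ℝ := Real.sqrt Y / (Q * R) with ha
  set b : ℝ := 1 / (R * U) with hb
  have ha0 : 0 < a := by positivity
  have hb0 : 0 < b := by positivity
  have hrhs : (Q * R / Real.sqrt Y) ^ (-A) + (R * U) ^ (-A) = a ^ A + b ^ A := by
    rw [← inv_rpow_eq_rpow_neg (by positivity), ← inv_rpow_eq_rpow_neg (by positivity), inv_div, ha, hb, one_div]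
  rw [hrhs]
  have haA : 0 ≤ a ^ A := Real.rpow_nonneg ha0.le _
  have hbA : 0 ≤ b ^ A := Real.rpow_nonneg hb0.le _
  -- the TRIVIAL bound `‖I‖ ≤ (β − α)·|C_w 0|·X`
  have htriv : ‖oscInt w h‖ ≤ |Cw 0| * X * (β - α) :=
    norm_oscInt_le_of_forall_le' h hαβ hw0 fun t _ => by
      have h0 := hwb 0 t
      rw [iteratedDeriv_zero, pow_zero, div_one] at h0
      exact h0.trans (mul_le_mul_of_nonneg_right (le_abs_self _) hX.le)
  -- CASE SPLIT: if `a > 1` or `b > 1` the claim is weaker than the trivial bound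
  by_cases hab : a ≤ 1 ∧ b ≤ 1
  swap
  · have h1 : 1 ≤ a ^ A + b ^ A := by
      rcases not_and_or.mp hab with h | h
      · exact le_add_of_le_of_nonneg (Real.one_le_rpow (le_of_not_ge h) hA) hbA
      · exact le_add_of_nonneg_of_le haA (Real.one_le_rpow (le_of_not_ge h) hA)
    calc ‖oscInt w h‖ ≤ |Cw 0| * X * (β - α) := htriv
      _ = |Cw 0| * (X * (β - α)) := by ring
      _ ≤ N₀ * Kb * (X * (β - α)) :=
          mul_le_mul_of_nonneg_right (hCw0.trans (le_mul_of_one_le_right hN₀0 hKb1))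
            (mul_nonneg hX.le (sub_nonneg.mpr hαβ))
      _ = N₀ * Kb * (β - α) * X * 1 := by ring
      _ ≤ N₀ * Kb * (β - α) * X * (a ^ A + b ^ A) := by
          refine mul_le_mul_of_nonneg_left h1 ?_
          exact mul_nonneg (mul_nonneg (mul_nonneg hN₀0 (zero_le_one.trans hKb1)) (sub_nonneg.mpr hαβ)) hX.le
  obtain ⟨ha1, hb1⟩ := hab
  -- the scales
  set ρ₀ : ℝ := 1 / Q + Y / (Q ^ 2 * R) with hρ₀
  have hρ₀0 : 0 ≤ ρ₀ := by positivity
  set ρ : ℝ := 1 / U + ρ₀ with hρ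
  have hρ0 : 0 ≤ ρ := by positivity
  have hρU : 1 / U ≤ ρ := le_add_of_nonneg_right hρ₀0
  have hρ₀ρ : ρ₀ ≤ ρ := le_add_of_nonneg_left (by positivity)
  -- the open set `U₀ = {h′ ≠ 0} ⊇ [α, β]` and `v = 1/h′`
  set U₀ : Set ℝ := {t : ℝ | deriv h t ≠ 0} with hU₀_def
  have hU₀ : IsOpen U₀ := isOpen_ne_fun (hh.continuous_deriv (by simp)) continuous_const
  have hIU : Icc α β ⊆ U₀ := fun t ht h0 => by
    have := hh' t ht; rw [h0, abs_zero] at this; exact absurd this (not_le.mpr hR)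
  set v : ℝ → ℝ := fun s => (deriv h s)⁻¹ with hv_def
  have hv : ContDiffOn ℝ ∞ v U₀ := (contDiff_infty_iff_deriv.mp hh).2.contDiffOn.inv fun _ ht => ht
  have hvh : ∀ t ∈ Icc α β, deriv h t * v t = 1 := fun t ht => mul_inv_cancel₀ (hIU ht)
  -- the reciprocal table `|v^{(j)}| ≤ Bv ρʲ`, `Bv = Bφ/R`
  set Bv : ℝ := 1 / R * Bφ with hBv
  have hBv0 : 0 ≤ Bv := by positivity
  have hvb : ∀ j ≤ n, ∀ t ∈ Icc α β, |iteratedDeriv j v t| ≤ Bv * ρ ^ j := by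
    intro j hj t ht
    have h1 := abs_iteratedDeriv_inv_deriv_le' hh hR hY0.le hQ n hhb hh' j hj t ht
    refine h1.trans ?_
    rw [hBv, hBφ, hM]
    exact mul_le_mul_of_nonneg_left (pow_le_pow_left₀ hρ₀0 hρ₀ρ j) (by positivity)
  -- the jets of `w`: `‖w^{(j)}‖ ≤ (N₀ X) ρʲ` for `j ≤ n`
  have hwN : ∀ j ≤ n, ∀ t ∈ Icc α β, ‖iteratedDeriv j w t‖ ≤ N₀ * X * ρ ^ j := by
    intro j hj t _
    refine (hwb j t).trans ?_
    have hj' : |Cw j| ≤ N₀ := Finset.single_le_sum (f := fun i => |Cw i|) (fun i _ => abs_nonneg _)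
      (Finset.mem_range.mpr (Nat.lt_succ_of_le hj))
    calc Cw j * X / U ^ j = Cw j * (X * (1 / U) ^ j) := by rw [one_div_pow]; field_simp
      _ ≤ |Cw j| * (X * (1 / U) ^ j) := mul_le_mul_of_nonneg_right (le_abs_self _) (by positivity)
      _ ≤ N₀ * (X * ρ ^ j) := mul_le_mul hj' (mul_le_mul_of_nonneg_left (pow_le_pow_left₀ (by positivity) hρU j) hX.le)
          (by positivity) hN₀0
      _ = N₀ * X * ρ ^ j := by ring
  -- the per-step factor `q = 2^{n+1} Bv ρ`
  set q : ℝ := 2 ^ (n + 1) * Bv * ρ with hq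
  have hq0 : 0 ≤ q := by positivity
  -- INDUCTION over the number of integrations by parts
  have key : ∀ k ≤ n, ∃ g : ℝ → ℂ, ContDiff ℝ ∞ g ∧ (∀ t ∉ Icc α β, g t = 0) ∧
      (∀ j ≤ n - k, ∀ t ∈ Icc α β, ‖iteratedDeriv j g t‖ ≤ N₀ * X * q ^ k * ρ ^ j) ∧
      oscInt w h = oscInt g h := by
    intro k
    induction k with
    | zero =>
      intro _
      refine ⟨w, hw, hw0, fun j hj t ht => ?_, rfl⟩
      rw [pow_zero, mul_one]; exact hwN j (by omega) t ht
    | succ k ih =>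
      intro hk
      obtain ⟨g, hg, hg0, hgb, hI⟩ := ih (Nat.le_of_succ_le hk)
      have hu : ContDiff ℝ ∞ (fun s => v s • g s) :=
        contDiff_smul_of_eq_zero_off' hU₀ isClosed_Icc hIU hv hg hg0
      refine ⟨fun s => Complex.I * deriv (fun r => v r • g r) s, contDiff_const.mul (contDiff_deriv_of_contDiff'' hu),
        fun t ht => ?_, fun j hj t ht => ?_, hI.trans (oscInt_eq_oscInt_step' hh hu hg0 hvh)⟩
      · have h0 : ∀ t ∉ Icc α β, (fun s => v s • g s) t = 0 := fun t ht => by simp [hg0 t ht]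
        show Complex.I * deriv (fun r => v r • g r) t = 0
        rw [deriv_eq_zero_off' isClosed_Icc h0 t ht, mul_zero]
      · have hstep := norm_iteratedDeriv_step_le' hU₀ hIU hv hg (m := n - (k + 1)) hρ0 hBv0
          (by positivity : (0:ℝ) ≤ N₀ * X * q ^ k)
          (fun j hj t ht => hvb j (by omega) t ht) (fun j hj t ht => hgb j (by omega) t ht) j hj t ht
        refine hstep.trans (mul_le_mul_of_nonneg_right ?_ (pow_nonneg hρ0 _))
        have h2 : (2 : ℝ) ^ (n - (k + 1) + 1) ≤ 2 ^ (n + 1) := pow_le_pow_right₀ one_le_two (by omega)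
        have hnn : 0 ≤ Bv * ρ * (N₀ * X * q ^ k) := by positivity
        calc 2 ^ (n - (k + 1) + 1) * Bv * ρ * (N₀ * X * q ^ k)
            = 2 ^ (n - (k + 1) + 1) * (Bv * ρ * (N₀ * X * q ^ k)) := by ring
          _ ≤ 2 ^ (n + 1) * (Bv * ρ * (N₀ * X * q ^ k)) := mul_le_mul_of_nonneg_right h2 hnn
          _ = N₀ * X * q ^ (k + 1) := by rw [hq]; ring
  obtain ⟨g, _, hg0, hgb, hI⟩ := key n le_rfl
  have hsup : ‖oscInt g h‖ ≤ N₀ * X * q ^ n * (β - α) :=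
    norm_oscInt_le_of_forall_le' h hαβ hg0 fun t ht => by
      have h0 := hgb 0 (Nat.zero_le _) t ht
      rwa [iteratedDeriv_zero, pow_zero, mul_one] at h0
  rw [hI]
  refine hsup.trans ?_
  -- arithmetic: `q ≤ 2^{n+1} Bφ · 3 max(a, b)` and `max(a,b)ⁿ ≤ max(a,b)^A ≤ a^A + b^A`
  set m : ℝ := max a b with hm
  have hm0 : 0 < m := lt_max_of_lt_left ha0
  have hm1 : m ≤ 1 := max_le ha1 hb1
  have hρR : ρ * (1 / R) ≤ 3 * m := by
    -- `ρ/R = b + 1/(QR) + a²`, `1/(QR) ≤ a` (as `√Y ≥ 1`), `a² ≤ a` (as `a ≤ 1`)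
    have h1 : ρ * (1 / R) = b + 1 / (Q * R) + a ^ 2 := by
      rw [hρ, hρ₀, hb, ha, div_pow, Real.sq_sqrt hY0.le]; field_simp; ring
    have h2 : 1 / (Q * R) ≤ a := by
      rw [ha]; exact div_le_div_of_nonneg_right hsY1 (by positivity)
    have h3 : a ^ 2 ≤ a := by rw [sq]; exact mul_le_of_le_one_left ha0.le ha1
    have h4 : a ≤ m := le_max_left _ _
    have h5 : b ≤ m := le_max_right _ _
    linarith
  have hq1 : q ≤ 3 * 2 ^ (n + 1) * Bφ * m := by
    have hnn : (0 : ℝ) ≤ 2 ^ (n + 1) * Bφ := by positivity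
    calc q = 2 ^ (n + 1) * Bφ * (ρ * (1 / R)) := by rw [hq, hBv]; ring
      _ ≤ 2 ^ (n + 1) * Bφ * (3 * m) := mul_le_mul_of_nonneg_left hρR hnn
      _ = 3 * 2 ^ (n + 1) * Bφ * m := by ring
  have hqn : q ^ n ≤ Kb * (a ^ A + b ^ A) := by
    calc q ^ n ≤ (3 * 2 ^ (n + 1) * Bφ * m) ^ n := pow_le_pow_left₀ hq0 hq1 n
      _ = Kb * m ^ n := by rw [hKb, mul_pow]
      _ ≤ Kb * m ^ A := mul_le_mul_of_nonneg_left (pow_natCeil_le_rpow hm0 hm1) (zero_le_one.trans hKb1)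
      _ ≤ Kb * (a ^ A + b ^ A) := by
          refine mul_le_mul_of_nonneg_left ?_ (zero_le_one.trans hKb1)
          rcases le_total a b with h | h
          · rw [hm, max_eq_right h]; exact le_add_of_nonneg_left haA
          · rw [hm, max_eq_left h]; exact le_add_of_nonneg_right hbA
  calc N₀ * X * q ^ n * (β - α) ≤ N₀ * X * (Kb * (a ^ A + b ^ A)) * (β - α) :=
        mul_le_mul_of_nonneg_right (mul_le_mul_of_nonneg_left hqn (by positivity)) (sub_nonneg.mpr hαβ)
    _ = N₀ * Kb * (β - α) * X * (a ^ A + b ^ A) := by ring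

end Main

end InertStationaryPhase

end Literature.Analysis.Fourier
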